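import Literature.NumberTheory.EllipticCurves.Kato2004.EulerSystemValues
import Literature.NumberTheory.EllipticCurves.Kato2004.IwasawaCohomologyExistsProofs
import HarnessLib

set_option autoImplicit false

/-!
# AUG engine, step 5: `F(χ̄(γ) − 1)` is well defined in `ℚ_p ⊗_ℚ ℂ` — the value `r(u − 1)` of a polynomial representative
# `r ≡ F (mod ω_n)` does not depend on `r`, because `ω_n(u − 1) = u^{p^n} − 1 = 0` for `u = 1 ⊗ χ̄(χ_cyc γ)` and a character `χ`
# of `Gal(ℚ_n/ℚ)` (seat `bsd-cm-prr-ty1` g14, cell `bsd-cm`; theorems only: no definition, no named fact, no instance, no `sorry`)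

Part 47 of the seat's kernel cut of stub 3 (cruxes stmt-BirchSwinnertonDyer-19945 / -19223).  Parts 43–46 (E30–E33) compare two
Kato families at every even character `χ` of `Gal(ℚ_n/ℚ)` through the numbers `r_F(u − 1)`, `r_G(u − 1)` (`u = 1 ⊗ χ⁻¹(χ_cyc γ)
∈ ℚ_p ⊗_ℚ ℂ`), where `r_F, r_G ∈ ℤ_p[X]` are ANY polynomial representatives of the Iwasawa functions `F, G ∈ Λ = ℤ_p⟦X⟧`
modulo `ω_n = (X + 1)^{p^n} − 1` (they exist: `IwasawaH1Exists.exists_polynomial_sub_coe_mem_span`, Weierstrass division).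
The endgame (Weierstrass preparation / separation of Iwasawa functions by characters) needs these numbers to be FUNCTIONS OF `F`
— i.e. independent of the representative.  THIS FILE proves it, in any commutative `ℤ_p`-algebra `A` at any `u` with `u^{p^n} = 1`:
* `aeval_sub_one_omega_of_comm` — `ω_n(u − 1) = u^{p^n} − 1`;
* `omega_dvd_sub_of_sub_mem_span` — two polynomial representatives of one `F` differ by a POLYNOMIAL multiple of `ω_n`
  (`Λ/(ω_n) ≅ ℤ_p[X]/(ω_n)`: Weierstrass division by the distinguished `ω_n`, tree `IwasawaH1Exists.isDistinguishedAt_omega` +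
  Mathlib `Polynomial.IsDistinguishedAt.algEquivQuotient`; the argument of the Sprung-side `omega_dvd_of_coe_dvd`, not imported);
* ★ `aeval_eq_aeval_of_sub_mem_span` — `r(u − 1) = r′(u − 1)` for `r ≡ r′ ≡ F (mod ω_n)` and `u^{p^n} = 1`;
* `one_tmul_inv_apply_pow_eq_one` — `u^{p^n} = 1` for `u = 1 ⊗ χ⁻¹(χ_cyc γ) ∈ ℚ_p ⊗_ℚ ℂ`, `γ` a topological generator over
  `ℚ_n`'s tower and `χ` a Dirichlet character mod `m` killing `χ_cyc(Gal(ℚ̄/ℚ_n))` (`γ^{p^n} ∈ Gal(ℚ̄/ℚ_n)`).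
HONEST LABEL: elementary algebra serving the seat's AUG engine; AUG displayed; no stub closed; nothing asserted on 19945 / 19223;
BSD is not proved for any curve.
References: [Washington1997] §7.1, Prop. 7.2, §13.1; [Lang1990] Ch. 5 §1–§2; [Kato2004Asterisque] §13.8 (p. 228).
-/

noncomputable section

open scoped BigOperators TensorProduct
open Polynomial Field
open Literature.NumberTheory.GaloisRepresentations
open Literature.NumberTheory.EllipticCurves Literature.NumberTheory.EllipticCurves.Kato2004

namespace Summit.BirchSwinnertonDyer.Rank1Residual.Additive.PerrinRiouUnit

/-! ## §1 Representatives modulo `ω_n` evaluate alike at `u` with `u^{p^n} = 1` -/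

section Omega

variable {p : ℕ} [Fact p.Prime] {A : Type*} [CommRing A] [Algebra ℤ_[p] A]

/-- `ω_n(u − 1) = u^{p^n} − 1` in a commutative `ℤ_p`-algebra. [cite: Washington1997, §7.1] -/
theorem aeval_sub_one_omega_of_comm (u : A) (n : ℕ) :
    aeval (u - 1) ((X + 1 : ℤ_[p][X]) ^ p ^ n - 1) = u ^ p ^ n - 1 := by
  simp [map_sub, map_pow, map_add, aeval_X, sub_add_cancel]

/-- **Two polynomial representatives of one Iwasawa function differ by a polynomial multiple of `ω_n`**
(`Λ/(ω_n) ≅ ℤ_p[X]/(ω_n)`, Weierstrass division by the distinguished polynomial `ω_n`).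
[cite: Washington1997, Prop. 7.2] [cite: Lang1990, Ch. 5 §2 Thm. 2.1] -/
theorem omega_dvd_sub_of_sub_mem_span (n : ℕ) {F : PowerSeries ℤ_[p]} {r r' : ℤ_[p][X]}
    (hr : F - (r : PowerSeries ℤ_[p]) ∈
      Ideal.span {(((Polynomial.X + 1 : ℤ_[p][X]) ^ p ^ n - 1 : ℤ_[p][X]) : PowerSeries ℤ_[p])})
    (hr' : F - (r' : PowerSeries ℤ_[p]) ∈
      Ideal.span {(((Polynomial.X + 1 : ℤ_[p][X]) ^ p ^ n - 1 : ℤ_[p][X]) : PowerSeries ℤ_[p])}) :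
    ((X + 1 : ℤ_[p][X]) ^ p ^ n - 1) ∣ r' - r := by
  set ω : ℤ_[p][X] := (X + 1 : ℤ_[p][X]) ^ p ^ n - 1 with hω
  have hmem : ((r' - r : ℤ_[p][X]) : PowerSeries ℤ_[p]) ∈ Ideal.span {(ω : PowerSeries ℤ_[p])} := by
    have h := sub_mem hr hr'
    rwa [sub_sub_sub_cancel_left, ← Polynomial.coe_sub] at h
  set e := (IwasawaH1Exists.isDistinguishedAt_omega p n).algEquivQuotient with he
  have h1 : Ideal.Quotient.mk (Ideal.span {(ω : PowerSeries ℤ_[p])}) ((r' - r : ℤ_[p][X]) : PowerSeries ℤ_[p]) = 0 :=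
    (Ideal.Quotient.eq_zero_iff_mem).mpr hmem
  have h2 : e (Ideal.Quotient.mk _ (r' - r)) = Ideal.Quotient.mk _ ((r' - r : ℤ_[p][X]) : PowerSeries ℤ_[p]) := by
    simp [he, Polynomial.IsDistinguishedAt.algEquivQuotient]
  have h3 : Ideal.Quotient.mk (Ideal.span {ω}) (r' - r) = 0 := by
    apply e.injective
    rw [h2, h1, map_zero]
  rwa [Ideal.Quotient.eq_zero_iff_mem, Ideal.mem_span_singleton] at h3

/-- **`r(u − 1) = r′(u − 1)` for two representatives `r ≡ r′ ≡ F (mod ω_n)` when `u^{p^n} = 1`.**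
[cite: Washington1997, §7.1 and Prop. 7.2] -/
theorem aeval_eq_aeval_of_sub_mem_span {u : A} {n : ℕ} (hu : u ^ p ^ n = 1) {F : PowerSeries ℤ_[p]} {r r' : ℤ_[p][X]}
    (hr : F - (r : PowerSeries ℤ_[p]) ∈
      Ideal.span {(((Polynomial.X + 1 : ℤ_[p][X]) ^ p ^ n - 1 : ℤ_[p][X]) : PowerSeries ℤ_[p])})
    (hr' : F - (r' : PowerSeries ℤ_[p]) ∈
      Ideal.span {(((Polynomial.X + 1 : ℤ_[p][X]) ^ p ^ n - 1 : ℤ_[p][X]) : PowerSeries ℤ_[p])}) :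
    aeval (u - 1) r = aeval (u - 1) r' := by
  obtain ⟨s, hs⟩ := omega_dvd_sub_of_sub_mem_span n hr hr'
  have e : r' = r + ((X + 1 : ℤ_[p][X]) ^ p ^ n - 1) * s := by rw [← hs]; ring
  rw [e, map_add, map_mul, aeval_sub_one_omega_of_comm, hu, sub_self, zero_mul, add_zero]

end Omega

/-! ## §2 `u = 1 ⊗ χ̄(χ_cyc γ)` satisfies `u^{p^n} = 1` for a character of `Gal(ℚ_n/ℚ)` -/

section Twist

variable {p : ℕ} [Fact p.Prime] {K : ZpExtension ℚ p} {γ : absoluteGaloisGroup ℚ} {m : ℕ} [NeZero m]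

/-- `γ^{p^n}` lies over `ℚ_n` and `χ` kills `χ_cyc(Gal(ℚ̄/ℚ_n))`, so `χ⁻¹(χ_cyc γ)^{p^n} = 1` and
`(1 ⊗ χ⁻¹(χ_cyc γ))^{p^n} = 1` in `ℚ_p ⊗_ℚ ℂ`. [cite: Washington1997, §13.1] [cite: Kato2004Asterisque, §13.8 (p. 228)] -/
theorem one_tmul_inv_apply_pow_eq_one (hγ : K.IsTopGenerator γ) (n : ℕ) (χ : DirichletCharacter ℂ m)
    (hχ : ∀ σ ∈ K.layerSubgroup n, χ ((modNCyclotomicCharacter ℚ m σ : (ZMod m)ˣ) : ZMod m) = 1) :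
    (((1 : ℚ_[p]) ⊗ₜ[ℚ] χ⁻¹ ((modNCyclotomicCharacter ℚ m γ : (ZMod m)ˣ) : ZMod m) : ℚ_[p] ⊗[ℚ] ℂ)) ^ p ^ n = 1 := by
  -- `γ^{p^n} ∈ Gal(ℚ̄/ℚ_n)` (the argument of `ZpExtension.pow_mem_layerSubgroup`, kept local)
  have hmem : γ ^ p ^ n ∈ K.layerSubgroup n := by
    have hγ' : K γ = Multiplicative.ofAdd 1 := hγ
    rw [ZpExtension.mem_layerSubgroup, map_pow, hγ', ← ofAdd_nsmul, toAdd_ofAdd, nsmul_eq_mul, mul_one, Nat.cast_pow]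
  have h1 : χ ((modNCyclotomicCharacter ℚ m γ : (ZMod m)ˣ) : ZMod m) ^ p ^ n = 1 := by
    rw [← map_pow, ← Units.val_pow_eq_pow_val, ← map_pow]
    exact hχ _ hmem
  rw [Algebra.TensorProduct.tmul_pow, one_pow, MulChar.inv_apply_eq_inv', inv_pow, h1, inv_one,
    ← Algebra.TensorProduct.one_def]

end Twist

end Summit.BirchSwinnertonDyer.Rank1Residual.Additive.PerrinRiouUnit

end
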